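import Literature.AlgebraicGeometry.HodgeTheory.HodgeLociAnalyticCoverOfWeightTwoFrames
import Mathlib.Analysis.Analytic.IsolatedZeros
import Mathlib.Topology.Compactness.Lindelof
import HarnessLib

/-!
# Over a ONE-DIMENSIONAL base the non-Hodge-generic points are COUNTABLE (Fritzsche–Grauert I.8: "if
# `n = 1`, then a nowhere dense analytic set consists only of isolated points"), CDK-free

Family `hodge`, layer `Literature/AlgebraicGeometry/HodgeTheory`. Theorems only (no definition, no named
fact). Written by the prover seat `hodge-nonav-prover-Ax` (g13, cell `hodge-nonav`), programme «AE»
(route `HodgeConjecture/CyclicUnitaryPowers`, `--supports stmt-HodgeConjecture-19544`).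

`HodgeLociAnalyticCoverOfWeightTwoFrames` shows that the non-Hodge-generic points of a projective family
of surfaces with holomorphic `F²`-frames lie in a COUNTABLE union of local analytic hypersurfaces
`{t ∈ W | g (ψ t) = 0}` (`g` holomorphic on the connected chart image `ψ(W) ⊆ ℂᵈ`, not identically
zero). When the base is a CURVE (`d = 1`) each such set is countable — the zeros of a non-trivial
holomorphic function of one variable on a connected open set are isolated (identity principle,
Mathlib's `AnalyticOnNhd.eqOn_zero_or_eventually_ne_zero_of_preconnected`), and a discrete subset of a
second countable space is countable — so the whole exceptional set is COUNTABLE: for one-parameter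
families the analytic «very general» IS the algebraic one (complement of countably many points), with
no appeal to Cattani–Deligne–Kaplan.

* `Set.Countable.zeroSet_of_analyticOnNhd_fin_one` — `{z ∈ U | g z = 0}` is countable for `U ⊆ ℂ¹`
  open connected and `g` holomorphic on `U`, non-zero somewhere on `U`.
* `countable_zeroSet_comp_chart_fin_one` — hence so is `{t ∈ W | g (ψ t) = 0}` for a chart `ψ` into `ℂ¹`.
* `countable_setOf_not_isHodgeGenericPoint_of_weightTwoFrames_curve` — for a projective family of
  surfaces over a smooth quasi-projective base of dimension `1` with `F²`-frames (hypotheses of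
  `exists_countable_analyticCover_not_isHodgeGenericPoint_of_weightTwoFrames` at `d = 1`), the set of
  non-Hodge-generic points is COUNTABLE; consumer form `exists_countable_isHodgeGenericPoint_…_curve`.

Honest scope: reductions (the frames `hF2` are a hypothesis; for the hypersurface pencils `familySpz`
over `𝔸¹` they are the tree's `exists_topFormFrame_familySpz_chartAt`). Hodge-genericity here is for
the transports of the ONE-PARAMETER family itself; nothing in this file says HC or any rung is proved.

## References

* [FritzscheGrauert2002] K. Fritzsche, H. Grauert, From Holomorphic Functions to Complex Manifolds,
  GTM 213 (2002), Ch. I §8 (after Prop. 8.1: for `n = 1` a nowhere dense analytic set is discrete).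
* [Deligne1972WeilK3] P. Deligne, La conjecture de Weil pour les surfaces K3, Invent. Math. 15 (1972),
  Prop. 7.5.
* [VoisinHodgeII2003] C. Voisin, Hodge Theory and Complex Algebraic Geometry II (2003), §5.3.1
  Lemma 5.13.
-/

noncomputable section

open CategoryTheory AlgebraicGeometry
open _root_.Topology _root_.Filter
open scoped TensorProduct
open Literature.AlgebraicTopology.SingularHomology
open Literature.AlgebraicGeometry.Motives

namespace Literature.AlgebraicGeometry.HodgeTheory

section HodgeTheory

/-! ### Zero sets of holomorphic functions of one variable are countable -/

section OneVariable

/-- **The zero set of a non-trivial holomorphic function on a connected open subset of `ℂ¹` is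
countable** (`U` connected, e.g. open connected; Fritzsche–Grauert, Ch. I §8: "If `n = 1`, then a nowhere dense analytic set consists only
of isolated points"; here: identity principle ⇒ the zeros are codiscrete-complemented in `U`
(`AnalyticOnNhd.eqOn_zero_or_eventually_ne_zero_of_preconnected`, read through `ℂ¹ ≃ ℂ`), and a
discrete subset of a second countable space is countable (`IsLindelof.countable_of_isDiscrete`)).
[cite: FritzscheGrauert2002, Chapter I §8, remark after Proposition 8.1 (case n = 1)] -/
theorem _root_.Set.Countable.zeroSet_of_analyticOnNhd_fin_one {U : Set (Fin 1 → ℂ)}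
    (hUc : IsConnected U) {g : (Fin 1 → ℂ) → ℂ} (hg : AnalyticOnNhd ℂ g U) (hne : ∃ z ∈ U, g z ≠ 0) :
    {z ∈ U | g z = 0}.Countable := by
  -- read through the linear identification `L : ℂ ≃ ℂ¹`
  let L : ℂ ≃L[ℂ] (Fin 1 → ℂ) := (ContinuousLinearEquiv.funUnique (Fin 1) ℂ ℂ).symm
  have hU' : IsPreconnected (L ⁻¹' U) := by
    rw [← L.image_symm_eq_preimage]
    exact (hUc.image _ L.symm.continuous.continuousOn).isPreconnected
  have hg' : AnalyticOnNhd ℂ (g ∘ L) (L ⁻¹' U) := fun x hx ↦ (hg (L x) hx).comp (L.analyticAt x)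
  rcases hg'.eqOn_zero_or_eventually_ne_zero_of_preconnected hU' with h0 | hcod
  · exfalso
    obtain ⟨z, hz, hgz⟩ := hne
    refine hgz ?_
    have h := h0 (show L.symm z ∈ L ⁻¹' U by
      change L (L.symm z) ∈ U; rwa [L.apply_symm_apply])
    simpa only [Function.comp_apply, L.apply_symm_apply, Pi.zero_apply] using h
  · -- the zeros of `g ∘ L` in `L⁻¹ U` are discrete, hence countable
    have hdisc : IsDiscrete ({x : ℂ | (g ∘ L) x = 0} ∩ L ⁻¹' U) := by
      refine isDiscrete_of_codiscreteWithin ?_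
      simpa only [Filter.Eventually, Set.compl_setOf, ne_eq] using hcod
    have hcount : ({x : ℂ | (g ∘ L) x = 0} ∩ L ⁻¹' U).Countable :=
      (HereditarilyLindelofSpace.isLindelof _).countable_of_isDiscrete hdisc
    -- push forward along `L`
    refine (hcount.image L).mono fun z hz ↦ ?_
    have h1 : g (L (L.symm z)) = 0 := by rw [L.apply_symm_apply]; exact hz.2
    have h2 : L (L.symm z) ∈ U := by rw [L.apply_symm_apply]; exact hz.1
    exact ⟨L.symm z, ⟨h1, h2⟩, L.apply_symm_apply z⟩

/-- **Chart version**: for a path-connected `W` inside the source of a chart `ψ : X → ℂ¹` and `g`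
holomorphic on `ψ(W)`, non-zero somewhere on it, the zero set `{t ∈ W | g (ψ t) = 0}` is countable.
[cite: FritzscheGrauert2002, Chapter I §8, remark after Proposition 8.1 (case n = 1)] -/
theorem countable_zeroSet_comp_chart_fin_one {X : Type*} [TopologicalSpace X] {W : Set X}
    (hWpc : IsPathConnected W) (ψ : OpenPartialHomeomorph X (Fin 1 → ℂ)) (hWψ : W ⊆ ψ.source)
    {g : (Fin 1 → ℂ) → ℂ} (hg : AnalyticOnNhd ℂ g (ψ '' W)) (hne : ∃ t₁ ∈ W, g (ψ t₁) ≠ 0) :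
    {t : X | t ∈ W ∧ g (ψ t) = 0}.Countable := by
  have hUc : IsConnected (ψ '' W) := (hWpc.image' (ψ.continuousOn.mono hWψ)).isConnected
  have hne' : ∃ z ∈ ψ '' W, g z ≠ 0 := by
    obtain ⟨t₁, ht₁, h⟩ := hne
    exact ⟨ψ t₁, Set.mem_image_of_mem _ ht₁, h⟩
  have hc := Set.Countable.zeroSet_of_analyticOnNhd_fin_one hUc hg hne'
  refine (hc.image ψ.symm).mono fun t ht ↦ ?_
  exact ⟨ψ t, ⟨Set.mem_image_of_mem _ ht.1, ht.2⟩, ψ.left_inv (hWψ ht.1)⟩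

end OneVariable

/-! ### One-parameter families of surfaces: the non-generic points are countable -/

section Curve

variable {𝒳 S : SchemeOver ℂ} (f : 𝒳 ⟶ S)

/-- **Over a curve, the non-Hodge-generic points of a projective family of surfaces with holomorphic
`F²`-frames form a COUNTABLE set** (Deligne 1972 Prop. 7.5 on a one-dimensional base, where «outside a
countable union of proper analytic subsets» means «outside a countable set»; hypotheses of
`exists_countable_analyticCover_not_isHodgeGenericPoint_of_weightTwoFrames` at `d = 1`). No
Cattani–Deligne–Kaplan: for one-parameter families the analytic and the algebraic «very general»
coincide. [cite: Deligne1972WeilK3, Prop. 7.5] [cite: VoisinHodgeII2003, §5.3.1 Lemma 5.13]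
[cite: FritzscheGrauert2002, Chapter I §8, remark after Proposition 8.1 (case n = 1)] -/
theorem countable_setOf_not_isHodgeGenericPoint_of_weightTwoFrames_curve [HodgeTensorFacts.{0, 0}]
    (hf : IsSmoothProjectiveFamily f 2) (hS : IsQuasiProjectiveOver S)
    [AlgebraicGeometry.SmoothOfRelativeDimension 1 S.hom]
    (hU : IsCohomologicallyLocallyTrivialOn f (Set.univ : Set (ComplexPoints S)))
    (A : ∀ t : ComplexPoints S, HodgeModel 2 (fiberOver f t)) (hA : ∀ t, (A t).IsHodgeSymmetric)
    [∀ t, Module.Finite ℚ (singularCohomology ℚ ℚ (ComplexPoints (fiberOver f t)) 2)]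
    {N₀ : ℕ} (hN₀ : 1 ≤ N₀) (ε : 𝒳 ⟶ projectiveSpace N₀ ℂ)
    (hε : ∀ t : ComplexPoints S, IsClosedImmersion (fiberι f t ≫ ε).left)
    (Good : OpenPartialHomeomorph (Set.univ : Set (ComplexPoints S)) (Fin 1 → ℂ) → Prop)
    (hF2 : ∀ (s t₁ : (Set.univ : Set (ComplexPoints S))), ∀ N ∈ 𝓝 t₁,
      ∀ (T₁ : singularCohomology ℚ ℚ (ComplexPoints (fiberOver f s.1)) 2 ≃ₗ[ℚ]
        singularCohomology ℚ ℚ (ComplexPoints (fiberOver f t₁.1)) 2),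
      (∃ δ₁ : Path.Homotopic.Quotient s t₁,
        ∀ v, ofRatClass _ 2 (T₁ v) = transportFun f 2 hU δ₁ (ofRatClass _ 2 v)) →
      ∃ W₀ : Set (Set.univ : Set (ComplexPoints S)), IsOpen W₀ ∧ t₁ ∈ W₀ ∧ W₀ ⊆ N ∧
        IsPathConnected W₀ ∧
      ∃ ψ : OpenPartialHomeomorph (Set.univ : Set (ComplexPoints S)) (Fin 1 → ℂ), Good ψ ∧ W₀ ⊆ ψ.source ∧
      ∃ (r₂ : ℕ) (w₂ : Fin r₂ → Set.Elem (Set.univ : Set (ComplexPoints S)) →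
        ℂ ⊗[ℚ] singularCohomology ℚ ℚ (ComplexPoints (fiberOver f s.1)) 2),
        (∀ t ∈ W₀, ∀ (ε' : Path t₁ t), (∀ r', ε' r' ∈ W₀) →
          ∀ (T : singularCohomology ℚ ℚ (ComplexPoints (fiberOver f s.1)) 2 ≃ₗ[ℚ]
            singularCohomology ℚ ℚ (ComplexPoints (fiberOver f t.1)) 2),
          (∀ v, ofRatClass _ 2 (T v) = transportFun f 2 hU ⟦ε'⟧ (ofRatClass _ 2 (T₁ v))) →
          LinearIndependent ℂ (fun i ↦ w₂ i t) ∧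
            (((A t.1).hodgeStructure (hf.isSmoothProjective t.1) (hA t.1) 2).comapEquiv T).F 2 =
              Submodule.span ℂ (Set.range fun i ↦ w₂ i t)) ∧
        (∀ (i : Fin r₂)
          (φ : Module.Dual ℂ (ℂ ⊗[ℚ] singularCohomology ℚ ℚ (ComplexPoints (fiberOver f s.1)) 2)),
          AnalyticOnNhd ℂ (fun z ↦ φ (w₂ i (ψ.symm z))) (ψ '' W₀)))
    :
    {t : (Set.univ : Set (ComplexPoints S)) | ¬ IsHodgeGenericPoint f 2 hU hf A hA t}.Countable := by
  obtain ⟨𝒞, h𝒞c, h𝒞s, hcov⟩ :=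
    exists_countable_analyticCover_not_isHodgeGenericPoint_of_weightTwoFrames f 1 hf hS hU A hA hN₀ ε hε
      Good hF2
  refine Set.Countable.mono hcov (h𝒞c.sUnion fun Z hZ ↦ ?_)
  obtain ⟨⟨W', ψ, g, -, -, hW'pc, hW'ψ, hg, hne, rfl⟩, -⟩ := h𝒞s Z hZ
  exact countable_zeroSet_comp_chart_fin_one hW'pc ψ hW'ψ hg hne

/-- **Consumer form**: a COUNTABLE subset `C ⊆ S(ℂ)` of the one-dimensional base off which every point
is Hodge generic. [cite: Deligne1972WeilK3, Prop. 7.5] [cite: VoisinHodgeII2003, §5.3.1 Lemma 5.13] -/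
theorem exists_countable_isHodgeGenericPoint_of_weightTwoFrames_curve [HodgeTensorFacts.{0, 0}]
    (hf : IsSmoothProjectiveFamily f 2) (hS : IsQuasiProjectiveOver S)
    [AlgebraicGeometry.SmoothOfRelativeDimension 1 S.hom]
    (hU : IsCohomologicallyLocallyTrivialOn f (Set.univ : Set (ComplexPoints S)))
    (A : ∀ t : ComplexPoints S, HodgeModel 2 (fiberOver f t)) (hA : ∀ t, (A t).IsHodgeSymmetric)
    [∀ t, Module.Finite ℚ (singularCohomology ℚ ℚ (ComplexPoints (fiberOver f t)) 2)]
    {N₀ : ℕ} (hN₀ : 1 ≤ N₀) (ε : 𝒳 ⟶ projectiveSpace N₀ ℂ)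
    (hε : ∀ t : ComplexPoints S, IsClosedImmersion (fiberι f t ≫ ε).left)
    (Good : OpenPartialHomeomorph (Set.univ : Set (ComplexPoints S)) (Fin 1 → ℂ) → Prop)
    (hF2 : ∀ (s t₁ : (Set.univ : Set (ComplexPoints S))), ∀ N ∈ 𝓝 t₁,
      ∀ (T₁ : singularCohomology ℚ ℚ (ComplexPoints (fiberOver f s.1)) 2 ≃ₗ[ℚ]
        singularCohomology ℚ ℚ (ComplexPoints (fiberOver f t₁.1)) 2),
      (∃ δ₁ : Path.Homotopic.Quotient s t₁,
        ∀ v, ofRatClass _ 2 (T₁ v) = transportFun f 2 hU δ₁ (ofRatClass _ 2 v)) →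
      ∃ W₀ : Set (Set.univ : Set (ComplexPoints S)), IsOpen W₀ ∧ t₁ ∈ W₀ ∧ W₀ ⊆ N ∧
        IsPathConnected W₀ ∧
      ∃ ψ : OpenPartialHomeomorph (Set.univ : Set (ComplexPoints S)) (Fin 1 → ℂ), Good ψ ∧ W₀ ⊆ ψ.source ∧
      ∃ (r₂ : ℕ) (w₂ : Fin r₂ → Set.Elem (Set.univ : Set (ComplexPoints S)) →
        ℂ ⊗[ℚ] singularCohomology ℚ ℚ (ComplexPoints (fiberOver f s.1)) 2),
        (∀ t ∈ W₀, ∀ (ε' : Path t₁ t), (∀ r', ε' r' ∈ W₀) →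
          ∀ (T : singularCohomology ℚ ℚ (ComplexPoints (fiberOver f s.1)) 2 ≃ₗ[ℚ]
            singularCohomology ℚ ℚ (ComplexPoints (fiberOver f t.1)) 2),
          (∀ v, ofRatClass _ 2 (T v) = transportFun f 2 hU ⟦ε'⟧ (ofRatClass _ 2 (T₁ v))) →
          LinearIndependent ℂ (fun i ↦ w₂ i t) ∧
            (((A t.1).hodgeStructure (hf.isSmoothProjective t.1) (hA t.1) 2).comapEquiv T).F 2 =
              Submodule.span ℂ (Set.range fun i ↦ w₂ i t)) ∧
        (∀ (i : Fin r₂)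
          (φ : Module.Dual ℂ (ℂ ⊗[ℚ] singularCohomology ℚ ℚ (ComplexPoints (fiberOver f s.1)) 2)),
          AnalyticOnNhd ℂ (fun z ↦ φ (w₂ i (ψ.symm z))) (ψ '' W₀)))
    :
    ∃ C : Set (ComplexPoints S), C.Countable ∧
      ∀ s : (Set.univ : Set (ComplexPoints S)), s.1 ∉ C → IsHodgeGenericPoint f 2 hU hf A hA s := by
  refine ⟨Subtype.val '' {t : (Set.univ : Set (ComplexPoints S)) | ¬ IsHodgeGenericPoint f 2 hU hf A hA t},
    (countable_setOf_not_isHodgeGenericPoint_of_weightTwoFrames_curve f hf hS hU A hA hN₀ ε hε Good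
      hF2).image _, fun s hs ↦ ?_⟩
  by_contra h
  exact hs ⟨s, h, rfl⟩

end Curve

end HodgeTheory

end Literature.AlgebraicGeometry.HodgeTheory

end
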